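import Summits.HodgeConjecture.HodgeConjecture.Theorems.WeilTypeLadderTwistDecomposable
import Summits.HodgeConjecture.HodgeConjecture.Theorems.WeilTypeLadderTwistInvariantPolarization
import Summits.HodgeConjecture.HodgeConjecture.Theorems.WeilTypeLadderCyclicPrymFifteenBiquadratic
import Summits.HodgeConjecture.HodgeConjecture.Theorems.WeilTypeLadderCyclicPrymTwentyBiquadratic
import Literature.AlgebraicGeometry.HodgeTheory.AbelianLowDimensionWeilReductionProofs
import Literature.AlgebraicGeometry.HodgeTheory.LefschetzOneOneHolds
import HarnessLib

/-!
# Weil-type ladder — THEOREM EXC (iii), instances: the `K′`-Weil classes of the seven exceptional composite families are ALGEBRAIC, fact-free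

b2b cell `hweil` (packet `run/shared/lean/b2b/hodge-weil/`), prover 3; report `b2b-hweil-pv3-g46/COMPACT-PAIRS.md` §7 and the kernel
theorem `weilClassesField_le_divisorClassesSpan_of_twist` (`…TwistDecomposable`). Here:

* §1 `weilClassesField_le_algebraicClasses_of_twist` — the generic corollary: under the hypotheses of the kernel theorem,
  `weilClassesField B θ P 4 ⊆ algebraicClasses B.X 2` (divisor polynomials are algebraic on an abelian variety: Lefschetz `(1,1)`,
  `lefschetzOneOne_rational_holds`, and products, `AbelianVariety.divisorClassesSpan_le_algebraicClasses` — tree THEOREMS).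
* `weilClassesField_le_algebraicClasses_of_twist'` — the polarization binder DISCHARGED by `exists_invariant_polarizationForm`
  (`…TwistInvariantPolarization`: average a polarization of the weight-one Hodge structure over `⟨s^*⟩`).
* §2 the FIVE arithmetic instances `(m, K′, θ, P, u)` that cover the seven Rohde-exceptional four-point families of abelian
  eightfolds (`u` = the twist of the extra automorphism `τ`, `τ ≫ s = s^u ≫ τ`; `K′ = ℚ(ζ_m)^{⟨−u⟩}`):
  `(15, ℚ(ζ₅), s³, Φ₅, 4)` [C23 `(1,4,5,5)`], `(15, ℚ(√-3,√5), s + s⁴ − s¹¹ − s¹⁴, T⁴ + 9T² + 9, 11)` [C30 `(1,9,9,11)`],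
  `(16, ℚ(ζ₈), s², Φ₈, 7)` [C25 `(1,3,5,7)`], `(20, ℚ(ζ₅), s⁴, Φ₅, 9)` [C24 `(1,5,5,9)`, `(1,9,15,15)`],
  `(20, ℚ(i,√5), s³ + s⁷, T⁴ + 3T² + 1, 11)` [C29 `(1,4,4,11)`, `(1,11,14,14)`]: for every complex abelian eightfold `B` with
  `Φ_m(s) = 0` and an endomorphism `τ` with a left inverse and `τ ≫ s = s^u ≫ τ`, EVERY class of
  `W_{K′} ⊗ ℂ = weilClassesField B θ P 4` is algebraic — with NO named fact (compare the `_of_facts` instances of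
  `…CyclicPrymQuarticCMField`, `…FifteenBiquadratic`, `…TwentyBiquadratic`, conditional on Shioda + Fulton + the datum).

HONEST LABEL: these classes are DECOMPOSABLE (divisor polynomials) — the families are not test cases of rung R3's exceptional
classes; the binders `τ`, `τ'` (existence of the twisting automorphism = THEOREM EXC (i) of the report, pen-and-paper: the
twisted Klein-four symmetry `uβ ≡ β∘π` realised by a Möbius involution) are the ONLY hypotheses beyond `Φ_m(s) = 0`, `dim B = 8`; 0 unconditional rungs above the floor; Markman-free; no `sorry`, no definition, no named fact.
[cite: Rohde2009CyclicCoverings, Ch. 6 §6.4] [cite: MoonenZarhin1998WeilClasses, §1] [cite: VoisinHodgeI2002, Thm. 11.30]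
-/

noncomputable section

-- every declaration of this problem lives in `Summit.HodgeConjecture.HodgeConjecture.…` (summit = sub-problem)
set_option linter.dupNamespace false

open CategoryTheory Polynomial
open scoped TensorProduct
open Literature.AlgebraicGeometry Literature.AlgebraicGeometry.Motives
open Literature.AlgebraicGeometry.HodgeTheory
open Literature.AlgebraicTopology.SingularHomology
open Literature.Barriers.HodgeConjecture (divisorClassesSpan)

namespace Summit.HodgeConjecture.HodgeConjecture.WeilTypeLadder

/-! ### §1 The generic corollary: the `K′`-Weil classes are algebraic -/

/-- **Corollary of THEOREM EXC (iii) (kernel form): the `K′`-Weil classes are ALGEBRAIC** — divisor polynomials are algebraic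
on an abelian variety (Lefschetz `(1,1)` + cup products of algebraic classes; tree theorems, no named fact).
[cite: VoisinHodgeI2002, Thm. 11.30] [cite: Fulton1998, §19.1–19.2] [cite: Rohde2009CyclicCoverings, Ch. 6 §6.4] -/
theorem weilClassesField_le_algebraicClasses_of_twist
    (B : AbelianVariety ℂ) (s τ τ' : B ⟶ B) (m u : ℕ) (Q P : Polynomial ℤ)
    (hm8 : Nat.totient m = 8) (hdim : B.dim = 8)
    (hs : Polynomial.eval₂ (Int.castRingHom (CategoryTheory.End B)) (CategoryTheory.End.of s)
      (Polynomial.cyclotomic m ℤ) = 0)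
    (hτ : τ ≫ s = CategoryTheory.End.asHom (CategoryTheory.End.of s ^ u) ≫ τ) (hτ' : τ' ≫ τ = 𝟙 B)
    (hu : u * u ≡ 1 [MOD m]) (hu1 : ¬ m ∣ u + 1)
    (hQ : ∀ c : ℂ, Polynomial.eval₂ (Int.castRingHom ℂ) c (Polynomial.cyclotomic m ℤ) = 0 →
      Polynomial.eval₂ (Int.castRingHom ℂ) (starRingEnd ℂ c ^ u) Q = Polynomial.eval₂ (Int.castRingHom ℂ) c Q)
    (hPm : P.Monic) (hPe : P.natDegree = 4) (hPirr : Irreducible (P.map (Int.castRingHom ℚ)))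
    (hPθ : Polynomial.eval₂ (Int.castRingHom (CategoryTheory.End B))
      ((CategoryTheory.End.asHom (Polynomial.eval₂ (Int.castRingHom (CategoryTheory.End B))
        (CategoryTheory.End.of s) Q) : B ⟶ B) : CategoryTheory.End B) P = 0)
    (ψ : LinearMap.BilinForm ℚ (bettiCohomology B.X 1)) (hψ : ψ.Nondegenerate)
    (hψs : ∀ x y : bettiCohomology B.X 1,
      ψ ((bettiCohomology.map s.hom.hom.hom 1).hom x) ((bettiCohomology.map s.hom.hom.hom 1).hom y) = ψ x y)
    (hψ10 : ∀ x y : ℂ ⊗[ℚ] bettiCohomology B.X 1,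
      ofRatClassBaseChange (Motives.ComplexPoints B.X) 1 x ∈
          hodgeOneZero (AbelianVariety.isSmoothProjective_holds (A := B)) →
        ofRatClassBaseChange (Motives.ComplexPoints B.X) 1 y ∈
          hodgeOneZero (AbelianVariety.isSmoothProjective_holds (A := B)) → ψ.baseChange ℂ x y = 0)
    (hψ01 : ∀ x y : ℂ ⊗[ℚ] bettiCohomology B.X 1,
      ofRatClassBaseChange (Motives.ComplexPoints B.X) 1 x ∈
          hodgeZeroOne (AbelianVariety.isSmoothProjective_holds (A := B)) →
        ofRatClassBaseChange (Motives.ComplexPoints B.X) 1 y ∈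
          hodgeZeroOne (AbelianVariety.isSmoothProjective_holds (A := B)) → ψ.baseChange ℂ x y = 0) :
    weilClassesField B (CategoryTheory.End.asHom (Polynomial.eval₂ (Int.castRingHom (CategoryTheory.End B))
        (CategoryTheory.End.of s) Q)) P 4 ≤ algebraicClasses B.X 2 :=
  (weilClassesField_le_divisorClassesSpan_of_twist B s τ τ' m u Q P hm8 hdim hs hτ hτ' hu hu1 hQ hPm hPe hPirr hPθ ψ hψ
    hψs hψ10 hψ01).trans (AbelianVariety.divisorClassesSpan_le_algebraicClasses B
      (fun b hb hb' => lefschetzOneOne_rational_holds (AbelianVariety.isSmoothProjective_holds (A := B)) b hb hb') 2)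

/-- **The same, with the polarization DISCHARGED**: an abelian variety with an endomorphism `s` of finite order carries an
`s`-invariant polarization form (`exists_invariant_polarizationForm`, file `…TwistInvariantPolarization`: average any polarization
of the weight-one Hodge structure on `H¹(B(ℂ); ℚ)` over `⟨s^*⟩`), so the only binders left are the twisting endomorphism `τ` and
its left inverse `τ'`. [cite: Rohde2009CyclicCoverings, Ch. 6 §6.4] [cite: VoisinHodgeI2002, §7.1.2 and Thm. 11.30] -/
theorem weilClassesField_le_algebraicClasses_of_twist'
    (B : AbelianVariety ℂ) (s τ τ' : B ⟶ B) (m u : ℕ) (Q P : Polynomial ℤ)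
    (hm8 : Nat.totient m = 8) (hdim : B.dim = 8)
    (hs : Polynomial.eval₂ (Int.castRingHom (CategoryTheory.End B)) (CategoryTheory.End.of s)
      (Polynomial.cyclotomic m ℤ) = 0)
    (hτ : τ ≫ s = CategoryTheory.End.asHom (CategoryTheory.End.of s ^ u) ≫ τ) (hτ' : τ' ≫ τ = 𝟙 B)
    (hu : u * u ≡ 1 [MOD m]) (hu1 : ¬ m ∣ u + 1)
    (hQ : ∀ c : ℂ, Polynomial.eval₂ (Int.castRingHom ℂ) c (Polynomial.cyclotomic m ℤ) = 0 →
      Polynomial.eval₂ (Int.castRingHom ℂ) (starRingEnd ℂ c ^ u) Q = Polynomial.eval₂ (Int.castRingHom ℂ) c Q)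
    (hPm : P.Monic) (hPe : P.natDegree = 4) (hPirr : Irreducible (P.map (Int.castRingHom ℚ)))
    (hPθ : Polynomial.eval₂ (Int.castRingHom (CategoryTheory.End B))
      ((CategoryTheory.End.asHom (Polynomial.eval₂ (Int.castRingHom (CategoryTheory.End B))
        (CategoryTheory.End.of s) Q) : B ⟶ B) : CategoryTheory.End B) P = 0) :
    weilClassesField B (CategoryTheory.End.asHom (Polynomial.eval₂ (Int.castRingHom (CategoryTheory.End B))
        (CategoryTheory.End.of s) Q)) P 4 ≤ algebraicClasses B.X 2 := by
  have hm : 0 < m := by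
    rcases Nat.eq_zero_or_pos m with h | h
    · subst h; rw [Nat.totient_zero] at hm8; exact absurd hm8 (by norm_num)
    · exact h
  obtain ⟨ψ, hψ, hψs, hψ10, hψ01⟩ :=
    exists_invariant_polarizationForm B s hm (pow_eq_one_of_eval₂_cyclotomic _ hs)
  exact weilClassesField_le_algebraicClasses_of_twist B s τ τ' m u Q P hm8 hdim hs hτ hτ' hu hu1 hQ hPm hPe hPirr hPθ ψ hψ
    hψs hψ10 hψ01

/-! ### §2 The five arithmetic instances -/

section Instances

variable (B : AbelianVariety ℂ) (s τ τ' : B ⟶ B)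

/-- Powers of a primitive `m`-th root reduce modulo `m`. [folklore] -/
theorem pow_eq_pow_of_isPrimitiveRoot {m : ℕ} {c : ℂ} (hc : IsPrimitiveRoot c m) (n k : ℕ) (h : n % m = k) :
    c ^ n = c ^ k := by
  rw [pow_eq_pow_mod n hc.pow_eq_one, h]

/-- The twist of a primitive `m`-th root: `conj(c)^u = c^((m-1)·u mod m)`. [folklore] -/
theorem conj_pow_eq_pow_of_isPrimitiveRoot {m : ℕ} (hm : 0 < m) {c : ℂ} (hc : IsPrimitiveRoot c m) (u k : ℕ)
    (h : (m - 1) * u % m = k) : starRingEnd ℂ c ^ u = c ^ k := by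
  rw [(conj_eq_pow_of_isPrimitiveRoot hm hc).2.2, ← pow_mul]
  exact pow_eq_pow_of_isPrimitiveRoot hc _ _ h

/-- **`(15, ℚ(ζ₅), θ = s³, Φ₅, u = 4)`** — the exceptional family `(15; 1,4,5,5)` [C23] (`K″ = ℚ(√-3,√5) = E^{⟨4⟩}`):
for an abelian eightfold `B` with `Φ₁₅(s) = 0`, a twisting endomorphism `τ ≫ s = s⁴ ≫ τ` with a left inverse,
`W_{ℚ(ζ₅)} ⊗ ℂ = weilClassesField B (s³) Φ₅ 4` consists of ALGEBRAIC classes (divisor polynomials). No named fact.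
[cite: Rohde2009CyclicCoverings, Ch. 6 §6.4] [cite: MoonenZarhin1998WeilClasses, §1] -/
theorem weilClassesField_cyclicPrymFifteen_zetaFive_le_algebraicClasses_of_twist (hdim : B.dim = 8)
    (hs : Polynomial.eval₂ (Int.castRingHom (CategoryTheory.End B)) (CategoryTheory.End.of s)
      (Polynomial.cyclotomic 15 ℤ) = 0)
    (hτ : τ ≫ s = CategoryTheory.End.asHom (CategoryTheory.End.of s ^ 4) ≫ τ) (hτ' : τ' ≫ τ = 𝟙 B) :
    weilClassesField B (s ≫ s ≫ s) (Polynomial.cyclotomic 5 ℤ) 4 ≤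
      algebraicClasses B.X 2 := by
  obtain ⟨h5m, h5e, h5irr⟩ := cyclotomic_five_monic_natDegree_irreducible
  have hθ : CategoryTheory.End.asHom (Polynomial.eval₂ (Int.castRingHom (CategoryTheory.End B))
      (CategoryTheory.End.of s) (X ^ 3 : Polynomial ℤ)) = s ≫ s ≫ s := by
    rw [Polynomial.eval₂_X_pow, ← end_of_comp_three]
  have h := weilClassesField_le_algebraicClasses_of_twist' B s τ τ' 15 4 (X ^ 3) (Polynomial.cyclotomic 5 ℤ) (by decide)
    hdim hs hτ hτ' (by decide) (by decide) (fun c hc => by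
      have hc' := isPrimitiveRoot_of_eval₂_cyclotomic (by norm_num) hc
      rw [Polynomial.eval₂_X_pow, Polynomial.eval₂_X_pow, conj_pow_eq_pow_of_isPrimitiveRoot (by norm_num) hc' 4 11 rfl,
        ← pow_mul, pow_eq_pow_of_isPrimitiveRoot hc' (11 * 3) 3 rfl]) h5m h5e h5irr
    (by rw [Polynomial.eval₂_X_pow]; exact eval₂_cyclotomic_five_pow_three _ hs)
  rw [hθ] at h
  exact h

/-- **`(15, ℚ(√-3,√5), θ = s + s⁴ − s¹¹ − s¹⁴, T⁴ + 9T² + 9, u = 11)`** — the exceptional family `(15; 1,9,9,11)` [C30]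
(`K″ = ℚ(ζ₅) = E^{⟨11⟩}`): `W_{ℚ(√-3,√5)} ⊗ ℂ` consists of ALGEBRAIC classes (divisor polynomials). No named fact.
[cite: Rohde2009CyclicCoverings, Ch. 6 §6.4] [cite: MoonenZarhin1998WeilClasses, §1] -/
theorem weilClassesField_cyclicPrymFifteen_biquadratic_le_algebraicClasses_of_twist (hdim : B.dim = 8)
    (hs : Polynomial.eval₂ (Int.castRingHom (CategoryTheory.End B)) (CategoryTheory.End.of s)
      (Polynomial.cyclotomic 15 ℤ) = 0)
    (hτ : τ ≫ s = CategoryTheory.End.asHom (CategoryTheory.End.of s ^ 11) ≫ τ) (hτ' : τ' ≫ τ = 𝟙 B) :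
    weilClassesField B (CategoryTheory.End.asHom (CategoryTheory.End.of s + CategoryTheory.End.of s ^ 4 -
        CategoryTheory.End.of s ^ 11 - CategoryTheory.End.of s ^ 14)) (X ^ 4 + 9 * X ^ 2 + 9 : Polynomial ℤ) 4 ≤
      algebraicClasses B.X 2 := by
  have hθ : Polynomial.eval₂ (Int.castRingHom (CategoryTheory.End B)) (CategoryTheory.End.of s)
      (X + X ^ 4 - X ^ 11 - X ^ 14 : Polynomial ℤ) =
      CategoryTheory.End.of s + CategoryTheory.End.of s ^ 4 - CategoryTheory.End.of s ^ 11 - CategoryTheory.End.of s ^ 14 := by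
    simp only [Polynomial.eval₂_add, Polynomial.eval₂_sub, Polynomial.eval₂_X, Polynomial.eval₂_X_pow]
  have h := weilClassesField_le_algebraicClasses_of_twist' B s τ τ' 15 11 (X + X ^ 4 - X ^ 11 - X ^ 14)
    (X ^ 4 + 9 * X ^ 2 + 9) (by decide) hdim hs hτ hτ' (by decide) (by decide) (fun c hc => by
      have hc' := isPrimitiveRoot_of_eval₂_cyclotomic (by norm_num) hc
      rw [conj_pow_eq_pow_of_isPrimitiveRoot (by norm_num) hc' 11 4 rfl]
      simp only [Polynomial.eval₂_add, Polynomial.eval₂_sub, Polynomial.eval₂_X, Polynomial.eval₂_X_pow, ← pow_mul]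
      rw [pow_eq_pow_of_isPrimitiveRoot hc' (4 * 4) 1 rfl, pow_eq_pow_of_isPrimitiveRoot hc' (4 * 11) 14 rfl,
        pow_eq_pow_of_isPrimitiveRoot hc' (4 * 14) 11 rfl, pow_one]
      ring) quarticFifteenBiq_monic quarticFifteenBiq_natDegree quarticFifteenBiq_irreducible
    (by rw [hθ]; exact eval₂_quarticFifteenBiq_phi _ hs)
  rw [hθ] at h
  exact h

/-- **`(16, ℚ(ζ₈), θ = s², Φ₈, u = 7)`** — the exceptional family `(16; 1,3,5,7)` [C25] (`K″ = ℚ(ζ₁₆)^{⟨7⟩}`):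
`W_{ℚ(ζ₈)} ⊗ ℂ = weilClassesField B (s²) Φ₈ 4` consists of ALGEBRAIC classes (divisor polynomials). No named fact.
[cite: Rohde2009CyclicCoverings, Ch. 6 §6.4] [cite: MoonenZarhin1998WeilClasses, §1] -/
theorem weilClassesField_cyclicPrymSixteen_zetaEight_le_algebraicClasses_of_twist (hdim : B.dim = 8)
    (hs : Polynomial.eval₂ (Int.castRingHom (CategoryTheory.End B)) (CategoryTheory.End.of s)
      (Polynomial.cyclotomic 16 ℤ) = 0)
    (hτ : τ ≫ s = CategoryTheory.End.asHom (CategoryTheory.End.of s ^ 7) ≫ τ) (hτ' : τ' ≫ τ = 𝟙 B) :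
    weilClassesField B (s ≫ s) (Polynomial.cyclotomic 8 ℤ) 4 ≤ algebraicClasses B.X 2 := by
  obtain ⟨h8m, h8e, h8irr⟩ := cyclotomic_eight_monic_natDegree_irreducible
  have hθ : CategoryTheory.End.asHom (Polynomial.eval₂ (Int.castRingHom (CategoryTheory.End B))
      (CategoryTheory.End.of s) (X ^ 2 : Polynomial ℤ)) = s ≫ s := by
    rw [Polynomial.eval₂_X_pow, ← end_of_comp_two]
  have h := weilClassesField_le_algebraicClasses_of_twist' B s τ τ' 16 7 (X ^ 2) (Polynomial.cyclotomic 8 ℤ) (by decide)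
    hdim hs hτ hτ' (by decide) (by decide) (fun c hc => by
      have hc' := isPrimitiveRoot_of_eval₂_cyclotomic (by norm_num) hc
      rw [Polynomial.eval₂_X_pow, Polynomial.eval₂_X_pow, conj_pow_eq_pow_of_isPrimitiveRoot (by norm_num) hc' 7 9 rfl,
        ← pow_mul, pow_eq_pow_of_isPrimitiveRoot hc' (9 * 2) 2 rfl]) h8m h8e h8irr
    (by rw [Polynomial.eval₂_X_pow]; exact eval₂_cyclotomic_eight_pow_two _ hs)
  rw [hθ] at h
  exact h

/-- **`(20, ℚ(ζ₅), θ = s⁴, Φ₅, u = 9)`** — the exceptional families `(20; 1,5,5,9)`, `(20; 1,9,15,15)` [C24]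
(`K″ = ℚ(i,√5) = E^{⟨9⟩}`): `W_{ℚ(ζ₅)} ⊗ ℂ = weilClassesField B (s⁴) Φ₅ 4` consists of ALGEBRAIC classes. No named fact.
[cite: Rohde2009CyclicCoverings, Ch. 6 §6.4] [cite: MoonenZarhin1998WeilClasses, §1] -/
theorem weilClassesField_cyclicPrymTwenty_zetaFive_le_algebraicClasses_of_twist (hdim : B.dim = 8)
    (hs : Polynomial.eval₂ (Int.castRingHom (CategoryTheory.End B)) (CategoryTheory.End.of s)
      (Polynomial.cyclotomic 20 ℤ) = 0)
    (hτ : τ ≫ s = CategoryTheory.End.asHom (CategoryTheory.End.of s ^ 9) ≫ τ) (hτ' : τ' ≫ τ = 𝟙 B) :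
    weilClassesField B (s ≫ s ≫ s ≫ s) (Polynomial.cyclotomic 5 ℤ) 4 ≤ algebraicClasses B.X 2 := by
  obtain ⟨h5m, h5e, h5irr⟩ := cyclotomic_five_monic_natDegree_irreducible
  have hθ : CategoryTheory.End.asHom (Polynomial.eval₂ (Int.castRingHom (CategoryTheory.End B))
      (CategoryTheory.End.of s) (X ^ 4 : Polynomial ℤ)) = s ≫ s ≫ s ≫ s := by
    rw [Polynomial.eval₂_X_pow, ← end_of_comp_four]
  have h := weilClassesField_le_algebraicClasses_of_twist' B s τ τ' 20 9 (X ^ 4) (Polynomial.cyclotomic 5 ℤ) (by decide)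
    hdim hs hτ hτ' (by decide) (by decide) (fun c hc => by
      have hc' := isPrimitiveRoot_of_eval₂_cyclotomic (by norm_num) hc
      rw [Polynomial.eval₂_X_pow, Polynomial.eval₂_X_pow, conj_pow_eq_pow_of_isPrimitiveRoot (by norm_num) hc' 9 11 rfl,
        ← pow_mul, pow_eq_pow_of_isPrimitiveRoot hc' (11 * 4) 4 rfl]) h5m h5e h5irr
    (by rw [Polynomial.eval₂_X_pow]; exact eval₂_cyclotomic_five_pow_four _ hs)
  rw [hθ] at h
  exact h

/-- **`(20, ℚ(i,√5), θ = s³ + s⁷, T⁴ + 3T² + 1, u = 11)`** — the exceptional families `(20; 1,4,4,11)`, `(20; 1,11,14,14)`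
[C29] (`K″ = ℚ(ζ₅) = E^{⟨11⟩}`): `W_{ℚ(i,√5)} ⊗ ℂ` consists of ALGEBRAIC classes (divisor polynomials). No named fact.
[cite: Rohde2009CyclicCoverings, Ch. 6 §6.4] [cite: MoonenZarhin1998WeilClasses, §1] -/
theorem weilClassesField_cyclicPrymTwenty_biquadratic_le_algebraicClasses_of_twist (hdim : B.dim = 8)
    (hs : Polynomial.eval₂ (Int.castRingHom (CategoryTheory.End B)) (CategoryTheory.End.of s)
      (Polynomial.cyclotomic 20 ℤ) = 0)
    (hτ : τ ≫ s = CategoryTheory.End.asHom (CategoryTheory.End.of s ^ 11) ≫ τ) (hτ' : τ' ≫ τ = 𝟙 B) :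
    weilClassesField B (CategoryTheory.End.asHom (CategoryTheory.End.of s ^ 3 + CategoryTheory.End.of s ^ 7))
      (X ^ 4 + 3 * X ^ 2 + 1 : Polynomial ℤ) 4 ≤ algebraicClasses B.X 2 := by
  have hθ : Polynomial.eval₂ (Int.castRingHom (CategoryTheory.End B)) (CategoryTheory.End.of s)
      (X ^ 3 + X ^ 7 : Polynomial ℤ) = CategoryTheory.End.of s ^ 3 + CategoryTheory.End.of s ^ 7 := by
    simp only [Polynomial.eval₂_add, Polynomial.eval₂_X_pow]
  have h := weilClassesField_le_algebraicClasses_of_twist' B s τ τ' 20 11 (X ^ 3 + X ^ 7) (X ^ 4 + 3 * X ^ 2 + 1)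
    (by decide) hdim hs hτ hτ' (by decide) (by decide) (fun c hc => by
      have hc' := isPrimitiveRoot_of_eval₂_cyclotomic (by norm_num) hc
      rw [conj_pow_eq_pow_of_isPrimitiveRoot (by norm_num) hc' 11 9 rfl]
      simp only [Polynomial.eval₂_add, Polynomial.eval₂_X_pow, ← pow_mul]
      rw [pow_eq_pow_of_isPrimitiveRoot hc' (9 * 3) 7 rfl, pow_eq_pow_of_isPrimitiveRoot hc' (9 * 7) 3 rfl]
      ring) quarticTwentyGolden_monic quarticTwentyGolden_natDegree quarticTwentyGolden_irreducible
    (by rw [hθ]; exact eval₂_quarticTwentyGolden_phi _ hs)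
  rw [hθ] at h
  exact h

/-! On path: every instance is a case of the summit (`hodgeConjectureFor_abelianVariety_of_hodgeConjecture` gives, for every complex
abelian variety, `HodgeConjectureFor B.dim B.X`, whose degree-`4` part contains these inclusions). -/

/-- Sanity (on path): the summit implies the conclusion of every instance above, since the classes of `weilClassesField B θ P 4`
that matter Summit-side are the rational `(2,2)` ones. Stated for the first instance's shape. [cite: Deligne2000, §1] -/
example (hH : _root_.HodgeConjecture) (θ : B ⟶ B) (P : Polynomial ℤ) :
    ∀ c ∈ weilClassesField B θ P 4, IsRationalClass c → IsOfHodgeType B.dim B.X 4 2 2 c → c ∈ algebraicClasses B.X 2 :=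
  fun c _ hcQ hcH => (hH (AbelianVariety.isSmoothProjective_holds (A := B))).2 2 c hcQ hcH

end Instances

end Summit.HodgeConjecture.HodgeConjecture.WeilTypeLadder

end
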